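import Summits.AtomisticToContinuum.HydrodynamicLimit.Theorems.InformationPercolationEngineChaosClosesEulerShellCoreA
import Summits.AtomisticToContinuum.HydrodynamicLimit.Theorems.InformationPercolationEngineChaosClosesEulerShellCoreB
import Summits.AtomisticToContinuum.HydrodynamicLimit.Theorems.InformationPercolationEngineChaosClosesEulerShellCoreC
import Summits.AtomisticToContinuum.HydrodynamicLimit.Theorems.InformationPercolationEngineChaosClosesEulerShellRHS
import Summits.AtomisticToContinuum.HydrodynamicLimit.Theorems.InformationPercolationEngineChaosClosesEulerShellInit
import Summits.AtomisticToContinuum.HydrodynamicLimit.Theorems.InformationPercolationEngineChaosClosesEulerShellL1Int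
import Summits.AtomisticToContinuum.HydrodynamicLimit.Theorems.InformationPercolationEngineChaosClosesEulerShellParam
import Summits.AtomisticToContinuum.HydrodynamicLimit.Theorems.InformationPercolationEngineChaosClosesEulerShellWindow
import Literature.MathematicalPhysics.KineticTheory.HardSphereEuler
import HarnessLib

/-!
# BF18 shell for functions (crux `ChaosClosesEuler`, stmt-AtomisticToContinuum-15141, line `Sketch`) —
# THE REGISTERED STUB `stub_bf18Shell` (skeleton v8): final assembly

WHAT. The deterministic core of the line: Březina–Feireisl's relative-energy weak–strong stability (BF18 §3) re-run for
a GENUINE measurable, bounded, admissible field `V = (ϱ, m, E)` on `[0, t] × 𝕋³` against a classical hard-sphere Euler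
solution in the band `ρσ³ ≤ η₁/2`, with a `C²` band extension `(χe, f)` of the hard-sphere equation of state.  Inputs:
(H1) continuity equation exactly, for `C¹` space–time tests; (H2) momentum tested with `ũ` up to `δ`; (H3) the CLAMPED
entropy inequality (cut-off value `a` on exactly-cold states) tested against `θ̃ · cut_{τ₀}` up to `δ`, every window;
(H4) global energy up to `δ`; (H5) sup-closeness `δ` at `τ = 0`.  Output: the time-averaged `L¹` distance over every
window `[τ₀, τ₀ + Δ]` is `≤ ε Δ`.

HOW (the assembly; every step is a landed helper).  `ShellData`: the solution is a classical `eos`-solution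
(`eos = monatomicExcess χe f`), data bounds `M, N`, compact range `K` on `[0, t']`, `t' = (t+T)/2`.  `ShellRHS`: the
pointwise package — clamp levels `a < b`, `rawRHS + divPU ≤ C ℰ_Z`, `0 ≤ ℰ_Z`, near/far coercivity (vacuum, cold and warm
states).  Given `ε`: field bounds `P` (`ShellField`), the `L¹` constant `L` (`ShellL1Int`), the a-priori level `C₂`, the
Grönwall parameters `u, Δ₀, A₀` (`ShellParam`); given `Δ`: the initial tolerance `η` for `κ = A₀/2` (`ShellInit`) and
`δ = min 1 (min η (A₀/6))`.  For a field `V`: `coreA` (measurable slice functional `F(s) = ∫ ℰ_Z`, `0 ≤ F ≤ C₂`,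
`F(0) ≤ κ`), `coreB` (the weighted inequality `∫ w F ≤ F(0) + 3δ + C ∫₀^{τ₀+Δ} F`: (H1) with the `C¹` test triple, (H2),
(H3) expanded, (H4), pressure FTC, `∫ divPU = 0`, `ShellTime`/`ShellWin` bookkeeping), the windowed Grönwall lemma
`ShellWindow` (`∫_{τ₀}^{τ₀+Δ} F ≤ Δ Γ`), and `coreC` (coercivity + AM–GM: `∫∫ D ≤ Δ L (Γ + √Γ) ≤ ε Δ`).

No named fact is invoked.
-/

noncomputable section

namespace Summit.AtomisticToContinuum.HydrodynamicLimit.Theorems.ChaosClosesEulerBF18Shell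

open Set MeasureTheory Function
open scoped InnerProductSpace BigOperators
open Literature.MathematicalPhysics.KineticTheory
open Literature.Analysis.FluidPDE Literature.Analysis.FluidPDE.CompressibleEuler
open Literature.Analysis.FluidPDE.CompressibleEuler.StrongPointData
open Literature.Analysis.FunctionSpaces

/-- **REGISTERED STUB `stub_bf18Shell` of crux `ChaosClosesEuler` (line `Sketch`, skeleton v8): the deterministic BF18
a-priori stability shell for genuine fields, hard-sphere class** — body VERBATIM `BF18ShellHS` of `Lines/Sketch.lean`.
See the module docstring for the assembly. [cite: BrezinaFeireisl2018, §3] -/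
theorem stub_bf18Shell :
    ∀ (σ : ℝ), 0 < σ → ∀ (η₁ : ℝ), 0 < η₁ → ∀ (χe f : ℝ → ℝ),
      ContDiffOn ℝ 2 χe (Set.Ioi 0) → ContDiffOn ℝ 2 f (Set.Ioi 0) →
      (∀ a, 0 < a → χe a = 1 + a * deriv f a) → (∀ a, 0 < a → 0 < χe a + a * deriv χe a) →
      (∃ B : ℝ, ∀ a, 0 < a → |χe a| ≤ B) →
      (∀ a, 0 < a → a * σ ^ 3 ≤ η₁ → f a = hsExcessFreeEnergy (a * σ ^ 3) ∧ χe a = hsCompressibility (a * σ ^ 3)) →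
      ∀ (T : ℝ) (ρ θ : ℝ → T3 → ℝ) (u : ℝ → T3 → V3), IsHardSphereEulerSolution σ T ρ u θ →
      (∀ s ∈ Set.Ico 0 T, ∀ x, ρ s x * σ ^ 3 ≤ η₁ / 2) →
      ∀ t ∈ Set.Ioo 0 T, ∃ a b : ℝ, a < b ∧ ∀ ε : ℝ, 0 < ε → ∃ Δ₀ : ℝ, 0 < Δ₀ ∧ ∀ Δ : ℝ, 0 < Δ → Δ ≤ Δ₀ → Δ < t →
      ∃ δ : ℝ, 0 < δ ∧ ∀ V : ℝ → T3 → ℝ × V3 × ℝ, Measurable (Function.uncurry V) →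
      (∃ C : ℝ, ∀ s x, |(V s x).1| ≤ C ∧ ‖(V s x).2.1‖ ≤ C ∧ |(V s x).2.2| ≤ C) →
      (∀ s x, 0 ≤ (V s x).1) → (∀ s x, 0 ≤ (V s x).2.2) →
      (∀ s x, ‖(V s x).2.1‖ ^ 2 ≤ 2 * (V s x).1 * (V s x).2.2) →
      let θo : ℝ × V3 × ℝ → ℝ := fun U => 2 / 3 * (U.2.2 / U.1 - ‖U.2.1‖ ^ 2 / (2 * U.1 ^ 2));
      let pV : ℝ × V3 × ℝ → ℝ := fun U => U.1 * θo U * χe U.1;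
      let Zs : ℝ × V3 × ℝ → ℝ := fun U => if 0 < θo U then max a (min (3 / 2 * Real.log (θo U) - Real.log U.1 - f U.1) b) else a;
      let Etot : ℝ → T3 → ℝ := fun s x => totalEnergyDensity (ρ s x) (u s x) (θ s x);
      let cut : ℝ → ℝ → ℝ := fun τ₀ s => Real.smoothTransition ((τ₀ + Δ - s) / Δ);
      (∀ φ : ℝ → T3 → ℝ, ContDiff ℝ 1 (Literature.Analysis.FunctionSpaces.Torus.stLift φ) → ∀ τ ∈ Set.Icc 0 t, (∫ x, φ τ x * (V τ x).1) - ∫ x, φ 0 x * (V 0 x).1 = ∫ s in Set.Icc 0 τ, ∫ x, (deriv (fun s' => φ s' x) s * (V s x).1 + ∑ k : Fin 3, (V s x).2.1 k * Literature.Analysis.FunctionSpaces.Torus.partialDeriv k (φ s) x)) →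
      (∀ τ ∈ Set.Icc 0 t, |(∫ x, ⟪u τ x, (V τ x).2.1⟫_ℝ) - (∫ x, ⟪u 0 x, (V 0 x).2.1⟫_ℝ) - ∫ s in Set.Icc 0 τ, ∫ x, (⟪Literature.Analysis.FunctionSpaces.Torus.timeDerivWithin (Set.Ico 0 T) u s x, (V s x).2.1⟫_ℝ + ∑ i : Fin 3, ∑ j : Fin 3, Literature.Analysis.FunctionSpaces.Torus.partialDeriv j (fun y => u s y i) x * ((V s x).2.1 i * (V s x).2.1 j / (V s x).1 + if i = j then pV (V s x) else 0))| ≤ δ) →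
      (∀ τ₀ ∈ Set.Icc 0 (t - Δ), (∫ s in Set.Icc 0 t, ∫ x, ((V s x).1 * Zs (V s x) * Literature.Analysis.FunctionSpaces.Torus.timeDerivWithin (Set.Ico 0 T) (fun s' y => θ s' y * cut τ₀ s') s x + Zs (V s x) * ⟪(V s x).2.1, Literature.Analysis.FunctionSpaces.Torus.gradient (fun y => θ s y * cut τ₀ s) x⟫_ℝ)) + ∫ x, (V 0 x).1 * Zs (V 0 x) * (θ 0 x * cut τ₀ 0) ≤ δ) →
      (∀ τ ∈ Set.Icc 0 t, ∫ x, (V τ x).2.2 ≤ (∫ x, (V 0 x).2.2) + δ) →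
      (∀ x, |(V 0 x).1 - ρ 0 x| ≤ δ ∧ ‖(V 0 x).2.1 - ρ 0 x • u 0 x‖ ≤ δ ∧ |(V 0 x).2.2 - Etot 0 x| ≤ δ) →
      ∀ τ₀ ∈ Set.Icc 0 (t - Δ), ∫ s in Set.Icc τ₀ (τ₀ + Δ), ∫ x, (|(V s x).1 - ρ s x| + ‖(V s x).2.1 - ρ s x • u s x‖ + |(V s x).2.2 - Etot s x|) ≤ ε * Δ := by
  intro σ _hσ η₁ hη₁ χe f hχ hf hvir hmono hBex hcomp T ρ θ u h hband t ht
  obtain ⟨B, hB⟩ := hBex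
  -- the equation of state and the classical solution
  obtain ⟨hG, hS, htemp, hepos, hχc, hfc⟩ := ChaosClosesEulerShellData.eos_package (f := f) hχ hf hvir hmono hB
  have hcl : IsClassicalEulerSolution (EulerEOS.monatomicExcess χe f) T ρ u θ :=
    ChaosClosesEulerShellData.classical h hband hη₁ (fun a ha hb => (hcomp a ha hb).2)
  -- an intermediate horizon `t < t' < T` and the data bounds on `[0, t']`
  have htt' : t < (t + T) / 2 := by linarith [ht.2]
  have ht'T : (t + T) / 2 < T := by linarith [ht.2]
  have ht'0 : (0 : ℝ) ≤ (t + T) / 2 := by linarith [ht.1, ht.2]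
  obtain ⟨M, N, hM0, hN0, hM, hN, hK, hKq, hmemK'⟩ := ChaosClosesEulerShellData.exists_bounds hcl hG ht'0 ht'T
  have hmemK : ∀ s ∈ Set.Icc 0 ((t + T) / 2), ∀ x, (ρ s x, θ s x) ∈
      (fun z : ℝ × T3 => (ρ z.1 z.2, θ z.1 z.2)) '' (Set.Icc 0 ((t + T) / 2) ×ˢ Set.univ) := fun s hs x => hmemK' s hs x
  -- the pointwise package (clamp levels `a < b`)
  obtain ⟨δK, a, b, C, c, hδK, hab, hC, hc, hKδ, hclampK, hpack⟩ :=
    ChaosClosesEulerShellRHS.stub_bf18ShellRHS χe f B hχ hf hvir hmono hB _ hK hKq M hM0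
  refine ⟨a, b, hab, fun ε hε => ?_⟩
  -- field bounds, the `L¹` constant, the a-priori level `C₂`, the Grönwall parameters
  obtain ⟨P, hP1, hρb, hub, hθb⟩ := ChaosClosesEulerShellField.exists_fieldBound hcl ht'T
  obtain ⟨L, hL0, hL⟩ := ChaosClosesEulerShellL1Int.stub_bf18ShellL1Int P c δK hc hδK (by linarith)
  set C₂ : ℝ := (1 + 3 * M) * (P * (P ^ 2 / 2 + 3 / 2 * P) + 2) + (3 * M + N + N * max |a| |b|) * (P + 1) + N with hC₂def
  have hZb0 : 0 ≤ max |a| |b| := le_max_of_le_left (abs_nonneg a)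
  have hC₂0 : 0 ≤ C₂ := by positivity
  obtain ⟨uu, Δ₀, hu0, hu1, hΔ₀, h4Δ₀, hpar⟩ :=
    ChaosClosesEulerShellParam.stub_bf18ShellParam t C C₂ L ε ht.1 hC.le hC₂0 hL0 hε
  refine ⟨Δ₀, hΔ₀, fun Δ hΔ hΔle hΔt => ?_⟩
  obtain ⟨A₀, hA₀, hΓ⟩ := hpar Δ hΔ hΔle
  -- the initial tolerance and the defect
  obtain ⟨η, hη, hinit⟩ := ChaosClosesEulerShellInit.stub_bf18ShellInit (EulerEOS.monatomicExcess χe f) hG hS htemp hepos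
    _ hK hKq M a b δK hδK hclampK (A₀ / 2) (by positivity)
  refine ⟨min 1 (min η (A₀ / 6)), lt_min one_pos (lt_min hη (by positivity)), ?_⟩
  set δ : ℝ := min 1 (min η (A₀ / 6)) with hδdef
  have hδ0 : 0 ≤ δ := (lt_min one_pos (lt_min hη (by positivity))).le
  have hδ1 : δ ≤ 1 := min_le_left _ _
  have hδη : δ ≤ η := (min_le_right _ _).trans (min_le_left _ _)
  have hδA : δ ≤ A₀ / 6 := (min_le_right _ _).trans (min_le_right _ _)
  intro V hV hCVex hV0 hVE hVm
  obtain ⟨CV, hCV⟩ := hCVex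
  dsimp only
  intro H1 H2 H3 H4 H5 τ₀ hτ₀
  -- part A: the slice functional, its bounds and its initial value
  obtain ⟨Fm, hFmeas, hFm, hF0, hFb, hF00⟩ := ChaosClosesEulerShellCoreA.coreA hχc hfc hB hcl hG ht.1 htt' ht'T hM0 hN0 hM hN hmemK hP1 hρb hub hθb
    hδK hab hC hc hKδ hpack hV hCV hV0 hVE hVm hδ0 hδ1 H1 H4 H5 hδη hinit
  -- part B: the weighted inequality, then the windowed Grönwall lemma
  have hB' := ChaosClosesEulerShellCoreB.coreB hχc hfc hB hcl hG ht.1 htt' ht'T hM0 hN0 hM hN hmemK hP1 hρb hub hθb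
    hδK hab hC hc hKδ hpack hV hCV hV0 hVE hVm hΔ hΔt H1 H2 H3 H4 hFm hF0
  have hA0 : 0 ≤ A₀ / 2 + 3 * δ := by positivity
  have hAA₀ : A₀ / 2 + 3 * δ ≤ A₀ := by linarith
  have h4Δ : 4 * Δ ≤ t := by linarith
  have hwin : ∀ τ₁ ∈ Set.Icc 0 (t - Δ),
      ∫ s in Set.Icc 0 t, -deriv (fun s' => Real.smoothTransition ((τ₁ + Δ - s') / Δ)) s * Fm s ≤
        (A₀ / 2 + 3 * δ) + C * ∫ s in Set.Icc 0 (τ₁ + Δ), Fm s := fun τ₁ hτ₁ => by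
    have := hB' τ₁ hτ₁; linarith
  have hwg := ChaosClosesEulerShell.stub_bf18ShellWindow Fm t Δ (A₀ / 2 + 3 * δ) C C₂ uu hFmeas hΔ h4Δ hA0 hC.le hC₂0
    hu0 hu1 hF0 hFb hwin τ₀ hτ₀
  obtain ⟨hΓ0, hΓε⟩ := hΓ (A₀ / 2 + 3 * δ) hA0 hAA₀
  -- part C: coercivity turns the window bound into the `L¹` bound
  have hC' := ChaosClosesEulerShellCoreC.coreC hχc hfc hB hcl hG ht.1 htt' ht'T hM0 hN0 hM hN hmemK hP1 hρb hub hθb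
    hδK hab hC hc hKδ hpack hV hCV hV0 hVE hVm hL0 hL hFm hΔ hτ₀ hΓ0 hwg
  calc _ ≤ Δ * (L * (((2 + 1 / (1 - Real.smoothTransition (1 - uu)) + 1 / Real.smoothTransition uu) * ((A₀ / 2 + 3 * δ) + C * ((C₂ * Δ + t * ((A₀ / 2 + 3 * δ) + C * C₂ * Δ)) * Real.exp (C * t) + C₂ * Δ)) + C₂ * uu) + Real.sqrt ((2 + 1 / (1 - Real.smoothTransition (1 - uu)) + 1 / Real.smoothTransition uu) * ((A₀ / 2 + 3 * δ) + C * ((C₂ * Δ + t * ((A₀ / 2 + 3 * δ) + C * C₂ * Δ)) * Real.exp (C * t) + C₂ * Δ)) + C₂ * uu))) := hC'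
    _ ≤ Δ * ε := mul_le_mul_of_nonneg_left hΓε hΔ.le
    _ = ε * Δ := mul_comm _ _

end Summit.AtomisticToContinuum.HydrodynamicLimit.Theorems.ChaosClosesEulerBF18Shell

end
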